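/-
Origin: expansion seat `planner-pub-hodgecm-prl2-g3-0`, handover v2 2026-08-18 (`HOME/pub-hodgecm-prl2-g3/lean/Prl2g3/HomSupplyReflex.lean`, md5 5d498b94, 106 lines);
landed by the gen-6 packager in gate run 22 as `HodgeCM/StubTree/HomSupplyReflex.lean` (import ^import Prl2g3\.ReflexInflate\b→import HodgeCM.CM.ReflexInflate ×1; import ^import Prl2g3\.→import HodgeCM.StubTree. ×1).
-/
/-
Origin: HOME/pub-hodgecm-prl2-g3/lean/Prl2g3/HomSupplyReflex.lean — session planner-pub-hodgecm-prl2-g3-0 (unit pub-hodgecm-prl2-g3, gen 3).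
Intended final place: `HodgeCM/StubTree/HomSupplyReflex.lean` (imports this seat's `HomSupplyLiu` and `ReflexInflate`, to be
renamed `HodgeCM.StubTree.HomSupplyLiu` / `HodgeCM.CM.ReflexInflate` by the packager).  Nothing asserted; kernel glue only.
-/
import Summits.HodgeConjecture.HodgeCM.StubTree.HomSupplyLiu
import Summits.HodgeConjecture.HodgeCM.CM.ReflexInflate

set_option autoImplicit false

/-!
# R3 made explicit: the dictionary with the candidate type `Φ(Ψ)`

`HodgeCM.LiuSupplyDatum.Dict` (THE OBSTRUCTION of the supply reduction) keeps its CM-type witness existential (`∃ Φ`),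
because WHICH type of `L` carries `Ψ` is the sign-exact convention question R3 (GAPS pv01-G1c, pv14-G1 (iv)).  Here the
candidate of REDUCTION-v3 §2 — the reflex-inflated type `Φ(Ψ) = CMTypeOps.reflexInflate j ι₁ hL Ψ`, a kernel-certified
CM type of `L` containing `ι₁` iff `ι₁ ∘ j ∈ Ψ` — is plugged in: `DictAt Φ` is the dictionary at a GIVEN type, `DictSharp`
the one at `Φ(Ψ)`, and `dict_of_dictAt` the one-line passage to `Dict`.  So once the dictionary owners confirm
"`Φ_μ = Φ(Ψ)`" against [Liu21] Def 4.5 (p0018 L66/L68), the statement to discharge is `DictSharp` verbatim; if they find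
the opposite convention, it is `DictAt` of the corrected type — `Dict` and everything downstream are unaffected.
-/

noncomputable section

namespace HodgeCM

open Literature.AlgebraicGeometry.Motives (CMType)

namespace LiuSupplyDatum

universe u

variable {L : CMField} (S : LiuSupplyDatum.{u} L)

/-- The dictionary at a prescribed CM type `Φ` of `L`: every weight-one conjugate-symplectic `μ` with `Φ_μ = Φ` and
`Hom_E(A_K, A_μ)_ℚ ≠ 0` at some level yields a level `Γ` of the tower of `V` and a morphism `P_Γ → A_{(K,Ψ)}` nonzero
on `H¹` (readings R1, R4 of `Dict`; R3 is now the CHOICE of `Φ`). -/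
def DictAt (U : Universe) {ι₁ : L →+* ℂ} (V : HermSpace3 L ι₁) (K : CMField) (Ψ : CMType K) (Φ : CMType L) : Prop :=
  ∀ (μ : S.D.Char) (Kl : S.D.Level), S.PhiMu μ = Φ → S.HomNZ Kl μ → ∃ Γ : Level V, U.HomNV (U.pms L ι₁ V Γ) K Ψ

/-- **The sharpened dictionary**: `DictAt` at the reflex-inflated type `Φ(Ψ)` (REDUCTION-v3 §2 R3 candidate). -/
def DictSharp (U : Universe) {ι₁ : L →+* ℂ} (V : HermSpace3 L ι₁) (K : CMField) (Ψ : CMType K) (j : K →+* L)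
    (hL : IsGalois ℚ L) : Prop :=
  S.DictAt U V K Ψ (CMTypeOps.reflexInflate j ι₁ hL Ψ)

variable {S}

/-- (Ported verbatim from the HodgeCMPerL package; no docstring in the source.) -/
theorem dict_of_dictAt {U : Universe} {ι₁ : L →+* ℂ} {V : HermSpace3 L ι₁} {K : CMField} {Ψ : CMType K}
    {Φ : CMType L} (h : S.DictAt U V K Ψ Φ) : S.Dict U V K Ψ :=
  ⟨Φ, h⟩

/-- (Ported verbatim from the HodgeCMPerL package; no docstring in the source.) -/
theorem dict_of_dictSharp {U : Universe} {ι₁ : L →+* ℂ} {V : HermSpace3 L ι₁} {K : CMField} {Ψ : CMType K}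
    {j : K →+* L} {hL : IsGalois ℚ L} (h : S.DictSharp U V K Ψ j hL) : S.Dict U V K Ψ :=
  dict_of_dictAt h

/-- One type, sharpened: `F418 ∧ FSmooth ∧ FChar ∧ FAdm ∧ DictSharp ⇒ ∃ Γ, HomNV (P_Γ) K Ψ`; the character used is one with
`Φ_μ = Φ(Ψ) ∋ ι₁` (by `FChar` at `Φ(Ψ)` and `CMTypeOps.self_mem_reflexInflate_iff`). -/
theorem homNV_of_liu_sharp {U : Universe} {ι₁ : L →+* ℂ} {V : HermSpace3 L ι₁} {K : CMField} {Ψ : CMType K}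
    {j : K →+* L} {hL : IsGalois ℚ L} (h1 : S.F418) (h2 : S.FSmooth) (h3 : S.FChar) (h4 : S.FAdm)
    (hD : S.DictSharp U V K Ψ j hL) : ∃ Γ : Level V, U.HomNV (U.pms L ι₁ V Γ) K Ψ :=
  homNV_of_liu h1 h2 h3 h4 (dict_of_dictSharp hD)

variable (S) in
/-- **R4 separated from R1/R3 (v2).**  The dictionary VIA Liu's own CM variety: for the chosen `L`-type `Φ`, every `μ`
with `Φ_μ = Φ` and `Hom_E(A_K, A_μ)_ℚ ≠ 0` gives a reference CM variety `A_{(M,Θ)}` of the Universe (reading: `M = M_μ`,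
`Θ = Θ_μ` the type of `A_μ ⊗_{E,ι₁} ℂ` — R1 + R3) which (R4, PRINT: Shimura 1998 §6.1 Thm 2 Cor., §6.2 Thm 3; = the first
clause of M38 `Fact_cmInflation` when `Θ` is `Ψ` inflated) is DOMINATED on `H¹` by a power of `A_{(K,Ψ)}` — a family
`p_j : A_{(M,Θ)} → A_{(K,Ψ)}` with `Σ_j p_j^*` surjective — and receives a morphism from some `P_Γ` nonzero on `H¹`.
`dict_of_dictVia` (kernel, M2 `Fact_pull_comp` via `Universe.homNV_of_dominated`) recovers `Dict`; so THE OBSTRUCTION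
splits as (R1+R3: Liu-side ⇒ `HomNV (P_Γ) M Θ`) ∧ (R4: domination, print). -/
def DictVia (U : Universe) {ι₁ : L →+* ℂ} (V : HermSpace3 L ι₁) (K : CMField) (Ψ : CMType K) : Prop :=
  ∃ Φ : CMType L, ∀ (μ : S.D.Char) (Kl : S.D.Level), S.PhiMu μ = Φ → S.HomNZ Kl μ →
    ∃ (M : CMField) (Θ : CMType M) (m : ℕ) (p : Fin m → U.Mor (U.cmAV M Θ) (U.cmAV K Ψ)),
      Function.Surjective
        (∑ j, U.pull (p j) 1 ∘ₗ LinearMap.proj j : (Fin m → U.Coh (U.cmAV K Ψ) 1) →ₗ[ℚ] U.Coh (U.cmAV M Θ) 1) ∧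
      ∃ Γ : Level V, U.HomNV (U.pms L ι₁ V Γ) M Θ

/-- (Ported verbatim from the HodgeCMPerL package; no docstring in the source.) -/
theorem dict_of_dictVia {U : Universe} (hc : U.Fact_pull_comp) {ι₁ : L →+* ℂ} {V : HermSpace3 L ι₁} {K : CMField}
    {Ψ : CMType K} (h : S.DictVia U V K Ψ) : S.Dict U V K Ψ := by
  obtain ⟨Φ, hΦ⟩ := h
  refine ⟨Φ, fun μ Kl hμ hH => ?_⟩
  obtain ⟨M, Θ, m, p, hp, Γ, hΓ⟩ := hΦ μ Kl hμ hH
  exact ⟨Γ, Universe.homNV_of_dominated hc p hp hΓ⟩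

end LiuSupplyDatum

namespace CMTypeOps

/-- In the PerL setting the candidate type contains `ι₁`: `ι₁ ∘ j = φ 0 ∈ tⁱ`. -/
theorem self_mem_reflexInflate_of_isPerLTypes {K L : CMField} (j : K →+* L) (hL : IsGalois ℚ L)
    {φ : Fin 3 → (K →+* ℂ)} {ι₁ : L →+* ℂ} (hι : ι₁.comp j = φ 0) {t : Fin 4 → CMType K} (ht : IsPerLTypes φ t)
    (i : Fin 4) : ι₁ ∈ (reflexInflate j ι₁ hL (t i)).1 := by
  rw [self_mem_reflexInflate_iff, hι]
  exact Universe.frame_mem_of_isPerLTypes ht i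

/-- In the face setting (`j = id`) the candidate type contains `ι₁`: admissibility. -/
theorem self_mem_reflexInflate_of_admissible {F : CMField} (hG : IsGalois ℚ F) (f : Face F) {ι₁ : F →+* ℂ}
    (hadm : f.Admissible ι₁) (i : Fin 4) : ι₁ ∈ (reflexInflate (RingHom.id F) ι₁ hG (f.psi i)).1 := by
  rw [self_mem_reflexInflate_iff, RingHom.comp_id]
  exact admissible_mem_psi f ι₁ hadm i

end CMTypeOps

end HodgeCM

end
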